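import Mathlib.Algebra.MvPolynomial.SchwartzZippel
import Mathlib.Algebra.MvPolynomial.Degrees
import Mathlib.Algebra.BigOperators.Finsupp.Basic
import Mathlib.GroupTheory.Index
import Mathlib.Analysis.SpecialFunctions.Pow.Real
import Literature.NumberTheory.DiophantineGeometry.CafureMatera
import Literature.RingTheory.MvPolynomial.AbsoluteIrreducibilityReduction
import HarnessLib

/-!
# Cafure–Matera (2006), Theorem 5.2 — the elementary regimes (proofs)

Sibling proof file of `CafureMatera.lean`, working towards the named fact
`Literature.NumberTheory.DiophantineGeometry.CafureMatera2006_thm52` (A. Cafure, G. Matera,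
*Improved explicit estimates on the number of solutions of equations over a finite field*, Finite
Fields Appl. 12 (2006) 155–185, **Theorem 5.2**, p. 171: for an absolutely irreducible
`𝔽_q`-hypersurface `H = V(f) ⊂ 𝔸ⁿ` of degree `δ`,
`|#(H ∩ 𝔽_qⁿ) − q^{n−1}| ≤ (δ−1)(δ−2)q^{n−3/2} + 5δ^{13/3}q^{n−2}`).

## What is proved here (sorry-free, no new definitions, no new named facts)

Following the printed proof (p. 171: "the theorem is obviously true if `δ = 1`") and the remark
after Lemma 2.1 (p. 159: "when `V` is a hypersurface defined by a polynomial `f` of degree `δ`,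
the lemma implies that the number of `q`-rational zeros of `f` is at most `δq^{n−1}`"):

* `IsAbsIrreducible.totalDegree_pos` — an absolutely irreducible polynomial is non-constant;
* `rationalPointCount_le_totalDegree_mul` — **Lemma 2.1, hypersurface case**:
  `#(V(f) ∩ 𝔽_qⁿ) ≤ δ q^{n−1}` for `f ≠ 0` (from Mathlib's Schwartz–Zippel lemma
  `MvPolynomial.schwartz_zippel_totalDegree`, in place of the printed route through
  [HS82, Prop. 2.3]);
* `eq_C_add_sum_of_totalDegree_le_one`, `rationalPointCount_eq_of_totalDegree_eq_one` — a
  polynomial of total degree `1` is affine-linear and its zero set is an affine hyperplane,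
  `#(V(f) ∩ 𝔽_qⁿ) = q^{n−1}`;
* `CafureMatera2006_thm52_of_totalDegree_eq_one` — **Theorem 5.2 for `δ = 1`**;
* `abs_rationalPointCount_sub_le_of_card_le`, `CafureMatera2006_thm52_of_card_le` —
  **Theorem 5.2 in the regime `q ≤ 5δ^{10/3}`**, where it follows from Lemma 2.1 alone:
  `|N − q^{n−1}| ≤ δq^{n−1} ≤ 5δ^{13/3}q^{n−2}`.

## What is NOT here (the remaining regime `q > 5δ^{10/3}`, `δ ≥ 2`, `n ≥ 2`)

The printed proof needs three further inputs, none of which is in the tree yet: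
(i) Lemma 5.1 = [Sch74, Lemma 5], Weil's estimate `|N − νq| ≤ ω(q,δ) + δ²` for a bivariate
polynomial with `ν` absolutely irreducible `𝔽_q`-factors (Weil 1948 for *singular* plane curves;
the tree has the Hasse–Weil theorem for function fields, `AlgFunctionField.hasseWeil_holds`, but
not the passage to singular affine plane models); (ii) the effective first Bertini theorem with
factors of bounded degree, Thm. 3.3 / Cor. 3.2 / Cor. 3.4 / Prop. 4.1 (Kaltofen 1995; the input of
Cor. 3.2 is the tree's unproved named fact
`Literature.RingTheory.MvPolynomial.kaltofen1995_effectiveBertini`); (iii) the averaging over the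
`𝔽_q`-planes of `𝔸ⁿ`, §5.1 (16)–(22).

## References

* [CafureMatera2006] A. Cafure, G. Matera, Finite Fields Appl. 12 (2006) 155–185, Lemma 2.1 and
  the remark following it (p. 159), Thm. 5.2 and the first line of its proof (p. 171).
-/

noncomputable section

open MvPolynomial Finset

namespace Literature.NumberTheory.DiophantineGeometry

variable {K : Type*} [Field K] {n : ℕ}

/-! ### Degree facts -/

/-- An absolutely irreducible polynomial has positive total degree: a constant is `0` or a unit in
`K̄[X₁,…,Xₙ]`, neither of which is irreducible. [folklore] -/
theorem IsAbsIrreducible.totalDegree_pos {f : MvPolynomial (Fin n) K} (hf : IsAbsIrreducible f) :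
    0 < f.totalDegree := by
  by_contra h
  have h0 : f.totalDegree = 0 := by omega
  rw [totalDegree_eq_zero_iff_eq_C] at h0
  have hf' : Irreducible (MvPolynomial.map (algebraMap K (AlgebraicClosure K)) f) := hf
  rw [h0, map_C] at hf'
  by_cases hc : f.coeff 0 = 0
  · apply hf'.ne_zero
    simp [hc]
  · exact hf'.not_isUnit
      (IsUnit.map C ((map_ne_zero (algebraMap K (AlgebraicClosure K))).mpr hc).isUnit)

/-- A polynomial of total degree `≤ 1` is affine-linear:
`f = coeff 0 f + Σᵢ coeff (eᵢ) f · Xᵢ`. [folklore] -/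
theorem eq_C_add_sum_of_totalDegree_le_one {σ : Type*} [Fintype σ] [DecidableEq σ]
    {f : MvPolynomial σ K} (hf : f.totalDegree ≤ 1) :
    f = C (f.coeff 0) + ∑ i, C (f.coeff (Finsupp.single i 1)) * X i := by
  classical
  ext d
  simp only [coeff_add, coeff_C, coeff_sum, coeff_C_mul, coeff_X, mul_ite, mul_one, mul_zero]
  by_cases hd0 : d = 0
  · subst hd0
    simp [Finsupp.single_eq_zero]
  · by_cases hd1 : ∃ i, d = Finsupp.single i 1
    · obtain ⟨i, rfl⟩ := hd1
      have h01 : ¬ ((0 : σ →₀ ℕ) = Finsupp.single i 1) := fun h => hd0 h.symm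
      simp only [h01, if_false, zero_add, Finsupp.single_left_inj one_ne_zero]
      rw [Finset.sum_ite_eq']
      simp
    · -- `d` has degree `≥ 2`, so `coeff d f = 0` and no `single i 1` equals `d`
      have h01 : ¬ ((0 : σ →₀ ℕ) = d) := fun h => hd0 h.symm
      have hdeg : f.totalDegree < d.sum fun _ e => e := by
        have hs0 : (d.sum fun _ e => e) ≠ 0 := by
          intro hs
          exact hd0 ((Finsupp.degree_eq_zero_iff d).mp hs)
        have hs1 : (d.sum fun _ e => e) ≠ 1 := fun hs => hd1 ((Finsupp.sum_eq_one_iff d).mp hs)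
        omega
      rw [coeff_eq_zero_of_totalDegree_lt hdeg]
      simp only [h01, if_false, zero_add]
      symm
      refine Finset.sum_eq_zero fun i _ => ?_
      rw [if_neg]
      exact fun h => hd1 ⟨i, h.symm⟩

variable [Fintype K] [DecidableEq K]

/-! ### Lemma 2.1 for hypersurfaces -/

/-- **Cafure–Matera, Lemma 2.1 (hypersurface case).** "When `V` is a hypersurface defined by a
polynomial `f ∈ 𝔽_q[X₁,…,Xₙ]` of degree `δ`, the lemma implies that the number of `q`-rational
zeros of `f` is at most `δq^{n−1}`" — for every non-zero `f` (for `n = 0` both sides are `0`).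
Proof: Mathlib's Schwartz–Zippel lemma. [cite: CafureMatera2006, Lemma 2.1 and remark p. 159] -/
theorem rationalPointCount_le_totalDegree_mul {f : MvPolynomial (Fin n) K} (hf : f ≠ 0) :
    rationalPointCount f ≤ f.totalDegree * Fintype.card K ^ (n - 1) := by
  cases n with
  | zero =>
    have hc : f.coeff 0 ≠ 0 := by
      intro h0
      apply hf
      rw [f.eq_C_of_isEmpty, h0, C_0]
    have hN : rationalPointCount f = 0 := by
      unfold rationalPointCount
      rw [Finset.card_eq_zero, Finset.filter_eq_empty_iff]
      intro x _ hx
      rw [f.eq_C_of_isEmpty, eval_C] at hx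
      exact hc hx
    simp [hN]
  | succ m =>
    have hSZ := MvPolynomial.schwartz_zippel_totalDegree hf (Finset.univ : Finset K)
    rw [Fintype.piFinset_univ, Finset.card_univ] at hSZ
    have hq : (0 : NNRat) < Fintype.card K := by exact_mod_cast Fintype.card_pos
    rw [div_le_div_iff₀ (by positivity) hq] at hSZ
    have hN : (Finset.univ.filter fun x : Fin (m + 1) → K => eval x f = 0).card =
        rationalPointCount f := rfl
    rw [hN] at hSZ
    have h2 : ((rationalPointCount f : ℕ) : NNRat) * Fintype.card K ≤
        ((f.totalDegree * Fintype.card K ^ m : ℕ) : NNRat) * Fintype.card K := by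
      calc ((rationalPointCount f : ℕ) : NNRat) * Fintype.card K
          ≤ (f.totalDegree : NNRat) * (Fintype.card K : NNRat) ^ (m + 1) := hSZ
        _ = ((f.totalDegree * Fintype.card K ^ m : ℕ) : NNRat) * Fintype.card K := by
          push_cast; ring
    have h3 := le_of_mul_le_mul_right h2 hq
    simp only [Nat.add_sub_cancel]
    exact_mod_cast h3

/-- Lemma 2.1 for an absolutely irreducible `f`: `#(H ∩ 𝔽_qⁿ) ≤ δ q^{n−1}`.
[cite: CafureMatera2006, Lemma 2.1 and remark p. 159] -/
theorem IsAbsIrreducible.rationalPointCount_le {f : MvPolynomial (Fin n) K}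
    (hf : IsAbsIrreducible f) :
    rationalPointCount f ≤ f.totalDegree * Fintype.card K ^ (n - 1) :=
  rationalPointCount_le_totalDegree_mul hf.ne_zero

/-! ### The case `δ = 1`: hyperplanes -/

/-- The zero set of a polynomial of total degree `1` over `𝔽_q` is an affine hyperplane of `𝔽_qⁿ`:
`#(V(f) ∩ 𝔽_qⁿ) = q^{n−1}` (all fibres of the non-constant affine map `x ↦ f(x)` have the same
size). This is the content of "the theorem is obviously true if `δ = 1`" (proof of Thm. 5.2).
[cite: CafureMatera2006, proof of Thm. 5.2, p. 171] -/
theorem rationalPointCount_eq_of_totalDegree_eq_one {f : MvPolynomial (Fin n) K}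
    (hf : f.totalDegree = 1) : rationalPointCount f = Fintype.card K ^ (n - 1) := by
  set c : K := f.coeff 0 with hc_def
  set a : Fin n → K := fun i => f.coeff (Finsupp.single i 1) with ha_def
  have hfeq : f = C c + ∑ i, C (a i) * X i := eq_C_add_sum_of_totalDegree_le_one hf.le
  -- some linear coefficient is non-zero
  obtain ⟨i₀, hi₀⟩ : ∃ i, a i ≠ 0 := by
    have hne : f.support.Nonempty := by
      rw [Finset.nonempty_iff_ne_empty, Ne, support_eq_empty]
      rintro rfl
      simp at hf
    obtain ⟨d, hd, hsup⟩ := Finset.exists_mem_eq_sup f.support hne (fun s => s.sum fun _ e => e)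
    have hd1 : (d.sum fun _ e => e) = 1 := by
      rw [← hsup]
      exact hf
    obtain ⟨i, rfl⟩ := (Finsupp.sum_eq_one_iff d).mp hd1
    exact ⟨i, mem_support_iff.mp hd⟩
  -- the linear part as an additive homomorphism
  let φ : (Fin n → K) →+ K :=
    { toFun := fun x => ∑ i, a i * x i
      map_zero' := by simp
      map_add' := fun x y => by
        simp only [Pi.add_apply, mul_add, Finset.sum_add_distrib] }
  have hφ : ∀ x, eval x f = c + φ x := by
    intro x
    conv_lhs => rw [hfeq]
    simp [φ, map_sum]
  have hsurj : ∀ t : K, t ∈ Set.range φ := fun t =>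
    ⟨Pi.single i₀ (t / a i₀), by
      simp only [φ, AddMonoidHom.coe_mk, ZeroHom.coe_mk, Pi.single_apply, mul_ite, mul_zero,
        Finset.sum_ite_eq', Finset.mem_univ, if_true]
      field_simp⟩
  -- all fibres of `φ` have the same size, and they partition `𝔽_qⁿ`
  have hfib : ∀ t : K, (Finset.univ.filter fun x : Fin n → K => φ x = t).card =
      (Finset.univ.filter fun x : Fin n → K => φ x = -c).card := fun t =>
    AddMonoidHom.card_fiber_eq_of_mem_range φ (hsurj t) (hsurj (-c))
  have hpart : (Finset.univ : Finset (Fin n → K)).card =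
      ∑ t : K, (Finset.univ.filter fun x : Fin n → K => φ x = t).card :=
    Finset.card_eq_sum_card_fiberwise (f := φ) (t := Finset.univ) (fun x _ => by simp)
  rw [Finset.sum_congr rfl (fun t _ => hfib t), Finset.sum_const, smul_eq_mul, Finset.card_univ,
    Finset.card_univ, Fintype.card_fun, Fintype.card_fin] at hpart
  -- the zero set of `f` is the fibre of `φ` over `-c`
  have hZ : rationalPointCount f = (Finset.univ.filter fun x : Fin n → K => φ x = -c).card := by
    unfold rationalPointCount
    congr 1
    apply Finset.filter_congr
    intro x _
    rw [hφ x]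
    constructor <;> intro h <;> linear_combination h
  -- `n ≥ 1` since `i₀ : Fin n`
  obtain ⟨m, rfl⟩ : ∃ m, n = m + 1 := ⟨n - 1, (Nat.succ_pred_eq_of_pos (Fin.pos i₀)).symm⟩
  rw [hZ]
  rw [pow_succ'] at hpart
  simpa using (Nat.eq_of_mul_eq_mul_left Fintype.card_pos hpart).symm

/-- **Cafure–Matera, Theorem 5.2 for `δ = 1`** ("the theorem is obviously true if `δ = 1`"):
a hyperplane has exactly `q^{n−1}` rational points, so the left-hand side vanishes.
[cite: CafureMatera2006, Thm. 5.2 (case δ = 1), p. 171] -/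
theorem CafureMatera2006_thm52_of_totalDegree_eq_one {f : MvPolynomial (Fin n) K}
    (hf : f.totalDegree = 1) :
    |(rationalPointCount f : ℝ) - (Fintype.card K : ℝ) ^ ((n : ℝ) - 1)| ≤
      ((f.totalDegree : ℝ) - 1) * ((f.totalDegree : ℝ) - 2) *
          (Fintype.card K : ℝ) ^ ((n : ℝ) - 3 / 2) +
        5 * (f.totalDegree : ℝ) ^ ((13 : ℝ) / 3) * (Fintype.card K : ℝ) ^ ((n : ℝ) - 2) := by
  have hN := rationalPointCount_eq_of_totalDegree_eq_one hf
  obtain ⟨m, rfl⟩ : ∃ m, n = m + 1 := by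
    cases n with
    | zero =>
      exfalso
      rw [f.eq_C_of_isEmpty, totalDegree_C] at hf
      exact zero_ne_one hf
    | succ m => exact ⟨m, rfl⟩
  have h1 : ((m + 1 : ℕ) : ℝ) - 1 = (m : ℝ) := by push_cast; ring
  rw [hN, hf, h1, Real.rpow_natCast]
  simp only [Nat.add_sub_cancel, Nat.cast_pow, sub_self, abs_zero, Nat.cast_one, zero_mul,
    Real.one_rpow, mul_one, zero_add]
  positivity

/-! ### The regime `q ≤ 5δ^{10/3}`: Theorem 5.2 from Lemma 2.1 alone -/

/-- **Theorem 5.2 in the regime `q ≤ 5δ^{10/3}`.** For a non-zero `f ∈ 𝔽_q[X₁,…,Xₙ]` of total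
degree `δ ≥ 1` with `q ≤ 5δ^{10/3}`, Lemma 2.1 gives `0 ≤ N ≤ δq^{n−1}`, hence
`|N − q^{n−1}| ≤ δq^{n−1} = δq · q^{n−2} ≤ 5δ^{13/3}q^{n−2}`, which is at most the right-hand
side of Theorem 5.2 since `(δ−1)(δ−2) ≥ 0` for `δ ∈ ℕ`. (Absolute irreducibility is not needed in
this regime.) [cite: CafureMatera2006, Thm. 5.2 and Lemma 2.1] -/
theorem abs_rationalPointCount_sub_le_of_card_le {f : MvPolynomial (Fin n) K} (hf : f ≠ 0)
    (hδ : 1 ≤ f.totalDegree)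
    (hq : (Fintype.card K : ℝ) ≤ 5 * (f.totalDegree : ℝ) ^ ((10 : ℝ) / 3)) :
    |(rationalPointCount f : ℝ) - (Fintype.card K : ℝ) ^ ((n : ℝ) - 1)| ≤
      ((f.totalDegree : ℝ) - 1) * ((f.totalDegree : ℝ) - 2) *
          (Fintype.card K : ℝ) ^ ((n : ℝ) - 3 / 2) +
        5 * (f.totalDegree : ℝ) ^ ((13 : ℝ) / 3) * (Fintype.card K : ℝ) ^ ((n : ℝ) - 2) := by
  -- `n ≥ 1`: over `Fin 0` every polynomial is constant
  obtain ⟨m, rfl⟩ : ∃ m, n = m + 1 := by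
    cases n with
    | zero =>
      exfalso
      rw [f.eq_C_of_isEmpty, totalDegree_C] at hδ
      exact Nat.not_succ_le_zero 0 hδ
    | succ m => exact ⟨m, rfl⟩
  have hNnat := rationalPointCount_le_totalDegree_mul hf
  simp only [Nat.add_sub_cancel] at hNnat
  set q : ℝ := (Fintype.card K : ℝ) with hq_def
  set δ : ℝ := (f.totalDegree : ℝ) with hδ_def
  have hq0 : 0 < q := by rw [hq_def]; exact_mod_cast Fintype.card_pos
  have hδ1 : (1 : ℝ) ≤ δ := by rw [hδ_def]; exact_mod_cast hδ
  have h1 : ((m + 1 : ℕ) : ℝ) - 1 = (m : ℝ) := by push_cast; ring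
  have h2 : ((m + 1 : ℕ) : ℝ) - 2 = (m : ℝ) - 1 := by push_cast; ring
  rw [h1, h2, Real.rpow_natCast]
  have hN : (rationalPointCount f : ℝ) ≤ δ * q ^ m := by
    rw [hδ_def, hq_def]; exact_mod_cast hNnat
  have hN0 : (0 : ℝ) ≤ rationalPointCount f := Nat.cast_nonneg _
  have hqm : 0 < q ^ m := pow_pos hq0 m
  -- `|N − q^m| ≤ δ q^m`
  have habs : |(rationalPointCount f : ℝ) - q ^ m| ≤ δ * q ^ m := by
    rw [abs_sub_le_iff]
    constructor
    · linarith
    · nlinarith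
  -- `δ q^m = δ q · q^{m-1} ≤ 5 δ^{13/3} q^{m-1}`
  have hsplit : q ^ m = q ^ ((m : ℝ) - 1) * q := by
    rw [Real.rpow_sub_one hq0.ne', Real.rpow_natCast, div_mul_cancel₀ _ hq0.ne']
  have hpow : δ ^ ((13 : ℝ) / 3) = δ * δ ^ ((10 : ℝ) / 3) := by
    rw [show (13 : ℝ) / 3 = 1 + 10 / 3 by norm_num, Real.rpow_add (by linarith), Real.rpow_one]
  have hr0 : 0 < q ^ ((m : ℝ) - 1) := Real.rpow_pos_of_pos hq0 _
  have hmain : δ * q ^ m ≤ 5 * δ ^ ((13 : ℝ) / 3) * q ^ ((m : ℝ) - 1) := by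
    rw [hsplit, hpow]
    have : δ * q ≤ δ * (5 * δ ^ ((10 : ℝ) / 3)) :=
      mul_le_mul_of_nonneg_left hq (by linarith)
    nlinarith
  -- the first term of the right-hand side is non-negative
  have hprod : 0 ≤ (δ - 1) * (δ - 2) * q ^ ((m : ℝ) + 1 - 3 / 2) := by
    apply mul_nonneg _ (Real.rpow_nonneg hq0.le _)
    rcases Nat.lt_or_ge (f.totalDegree) 2 with hlt | hge
    · have : f.totalDegree = 1 := by omega
      have : δ = 1 := by rw [hδ_def, this, Nat.cast_one]
      rw [this]; norm_num
    · have : (2 : ℝ) ≤ δ := by rw [hδ_def]; exact_mod_cast hge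
      nlinarith
  have hcast : ((m + 1 : ℕ) : ℝ) - 3 / 2 = (m : ℝ) + 1 - 3 / 2 := by push_cast; ring
  rw [hcast]
  linarith

/-- **Cafure–Matera, Theorem 5.2 in the regime `q ≤ 5δ^{10/3}`**, for an absolutely irreducible
`f` (so `f ≠ 0` and `δ ≥ 1`): the printed estimate holds by Lemma 2.1 alone.
[cite: CafureMatera2006, Thm. 5.2 and Lemma 2.1] -/
theorem CafureMatera2006_thm52_of_card_le {f : MvPolynomial (Fin n) K} (hf : IsAbsIrreducible f)
    (hq : (Fintype.card K : ℝ) ≤ 5 * (f.totalDegree : ℝ) ^ ((10 : ℝ) / 3)) :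
    |(rationalPointCount f : ℝ) - (Fintype.card K : ℝ) ^ ((n : ℝ) - 1)| ≤
      ((f.totalDegree : ℝ) - 1) * ((f.totalDegree : ℝ) - 2) *
          (Fintype.card K : ℝ) ^ ((n : ℝ) - 3 / 2) +
        5 * (f.totalDegree : ℝ) ^ ((13 : ℝ) / 3) * (Fintype.card K : ℝ) ^ ((n : ℝ) - 2) :=
  abs_rationalPointCount_sub_le_of_card_le hf.ne_zero hf.totalDegree_pos hq

end Literature.NumberTheory.DiophantineGeometry

end
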